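import Literature.MathematicalPhysics.QuantumLattice.TranslationInvariantGroundStatesAreMeanEnergyMinimisers
import Literature.MathematicalPhysics.QuantumLattice.LayeredSystemPartitionFunction
import Literature.MathematicalPhysics.QuantumLattice.HubbardFermionInteractionLocalHamiltonian
import HarnessLib

/-!
# Translation covariance of free-boundary local Hamiltonians, collars of translated regions, and the decoupled Hamiltonian over a family
# of translated boxes: `Γ(τ_v) H_Λ = H_{Λ+v}`, `Z_{Λ'}(Γ H) = 2^{Δ} Z_Λ(H)`, `Σ_k Γ_k H_{Λ₀} = Σ_k Γ(H_{Λ₀ + v_k})`, `log Z = |K| log Z_{Λ₀}`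

Topic `Literature/MathematicalPhysics/QuantumLattice` (family `hubbard`; crew hubbard-fast S2 «T > 0 / families of models»). Stepping stones for the
THERMODYNAMIC LIMIT OF THE FREE-BOUNDARY PRESSURE of a general translation-invariant finite-range fermion interaction (the box-tiling argument:
`log Z_{[0,km)^d} = k^d log Z_{[0,m)^d} ± |β|·(cross terms)`; the companion `VariationalPressureBoxPartitionFunctionBound` bounds the variational
pressure by box partition functions). Proved here, for a FermionInteraction `Ψ` on `ℤ^d`:

* §1 `thicken_shiftSet` (`thicken (Λ+v) R = (thicken Λ R) + v`) and the translation invariance of the collar cardinality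
  (`card_thicken_shiftSet_sdiff`).
* §2 **COVARIANCE** `IsTranslationInvariant.fermionEmbed_shiftEmb_localHamiltonian`: `Γ(τ_v)(H_Λ) = H_{Λ+v}` for a translation-covariant `Ψ`
  (`Φ(X+v) = Γ(τ_v)Φ(X)` termwise, reindexing `X ↦ X + v` of the subsets); with a further inclusion (`…_trans_incl`).
* §3 `partitionFn_fermionEmbed` / `log_partitionFn_fermionEmbed`: embedding a Hamiltonian into a larger region multiplies `Z` by `2^{ΔOrb}`
  (`log Z` shifts by `ΔOrb · log 2`), `card_orb_polySite` (`|Orb Λ| = 2|Λ|`).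
* §4 **Decoupled Hamiltonians over translated copies of a region**: for translates `Λ₀ + v_k ⊆ Λ'` (legs `τ_{v_k}` followed by isotony),
  `decoupledSum = Σ_k Γ(H_{Λ₀ + v_k})` (`decoupledSum_translates_eq`); disjoint translates give disjoint legs (`disjoint_legs_of_disjoint_shiftSet`);
  and when the translates TILE `Λ'` (`|Λ'| = |K|·|Λ₀|`), `log Re Z_{Λ'}(Σ_k Γ H_{Λ₀+v_k}) = |K| · log Re Z_{Λ₀}(H_{Λ₀})` for a Hermitian even `Ψ`
  (`log_partitionFn_decoupledSum_translates`, from `LayeredSystemPartitionFunction.log_partitionFn_decoupledSum`).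

Everything is PROVED; no definition, no named fact, no number. NOT here (next file): the straddling terms `H_{Λ'} − Σ_k Γ H_{Λ₀+v_k}`, their norm
`≤ |K|·|collar|·S_Ψ`, and the limit `n^{-d} log Z_{[0,n)^d} → P_free(β,Ψ)`.

## Mathlib / tree search

REUSED: `thicken`, `thicken_singleton_eq` family, `localHamiltonian`, `localHamiltonian_eq_sum`, `localHamiltonian_isHermitian`,
`parityAut_localHamiltonian`, `FermionInteraction.IsTranslationInvariant`, `PolySite.shiftEmb/incl`, `fermionEmbed_fermionEmbed/_congr`,
`shiftSet`, `mem_shiftSet` (`InfVolFermionState`, `PolymerPressure`); `fermionEmbed_exp`, `decoupledSum`, `log_partitionFn_decoupledSum`,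
`isHermitian_decoupledSum` (`LayeredSystemPartitionFunction`); `trace_fermionEmbed`; Mathlib `Finset.sum_nbij'`, `Finset.image_sdiff`.
`lean search 'localHamiltonian_shift|thicken_shiftSet|partitionFn_fermionEmbed'` (2026-08-28): spin-system analogue `transportOp_shift_localHamiltonian` only.

## References

* O. Bratteli, D. W. Robinson, *OAQSM 2* (1997), §6.2.1 (translation-covariant interactions, `H_Φ(Λ + a) = τ_a H_Φ(Λ)`), §6.2.4.
  [cite: BratteliRobinsonII1997, §6.2.4 (Prop. 6.2.39 ff.)]
* H. Araki, H. Moriya, Rev. Math. Phys. 15 (2003) 93, §5.1 (local Hamiltonians), §8 (translation-covariant potentials). [cite: ArakiMoriya2003, §5.1 (local Hamiltonian H(I))]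
* B. Simon, *The Statistical Mechanics of Lattice Gases* I (1993), §II.2 (existence of the pressure by box tiling). [cite: BratteliKishimotoRobinson1978, Thm. 2 (proof, p. 48)]
-/

noncomputable section

open scoped ComplexOrder BigOperators
open Finset

namespace Literature.MathematicalPhysics.QuantumLattice

open Matrix HubbardWave0 Literature.Probability.LatticeModels ThermodynamicLimit

variable {d : ℕ}

/-! ### §1 Collars of translated regions -/

/-- **`thicken (Λ + v) R = (thicken Λ R) + v`.** [cite: BratteliRobinsonII1997, §6.2.1] -/
theorem thicken_shiftSet (v : Site d) (Λ : Finset (Site d)) (R : ℝ) :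
    thicken (shiftSet v Λ) R = shiftSet v (thicken Λ R) := by
  ext z
  rw [mem_shiftSet, thicken, thicken, Finset.mem_biUnion, Finset.mem_biUnion]
  constructor
  · rintro ⟨y, hy, hz⟩
    rw [mem_shiftSet] at hy
    rw [Finset.mem_image] at hz
    obtain ⟨w, hw, rfl⟩ := hz
    refine ⟨y - v, hy, Finset.mem_image.2 ⟨w, hw, ?_⟩⟩
    abel
  · rintro ⟨y, hy, hz⟩
    rw [Finset.mem_image] at hz
    obtain ⟨w, hw, hwz⟩ := hz
    refine ⟨y + v, by rwa [mem_shiftSet, add_sub_cancel_right], Finset.mem_image.2 ⟨w, hw, ?_⟩⟩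
    have : z = y + w + v := by rw [hwz]; abel
    rw [this]; abel

/-- Translation commutes with set difference. [cite: BratteliRobinsonII1997, §6.2.1] -/
theorem shiftSet_sdiff (v : Site d) (A B : Finset (Site d)) : shiftSet v (A \ B) = shiftSet v A \ shiftSet v B := by
  ext x
  rw [mem_shiftSet, Finset.mem_sdiff, Finset.mem_sdiff, mem_shiftSet, mem_shiftSet]

/-- **The collar cardinality is translation invariant**: `|thicken (Λ+v) R ∖ (Λ+v)| = |thicken Λ R ∖ Λ|`. [cite: BratteliRobinsonII1997, §6.2.1] -/
theorem card_thicken_shiftSet_sdiff (v : Site d) (Λ : Finset (Site d)) (R : ℝ) :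
    (thicken (shiftSet v Λ) R \ shiftSet v Λ).card = (thicken Λ R \ Λ).card := by
  rw [thicken_shiftSet, ← shiftSet_sdiff, shiftSet_eq_map, Finset.card_map]

/-- Composition of translations of regions. [cite: ArakiMoriya2003, §4.1 Def. 4.3] -/
private theorem shiftSet_shiftSet' (a b : Site d) (A : Finset (Site d)) : shiftSet b (shiftSet a A) = shiftSet (a + b) A := by
  ext y
  rw [mem_shiftSet, mem_shiftSet, mem_shiftSet, show y - b - a = y - (a + b) by abel]

/-! ### §2 Translation covariance of the local Hamiltonians -/

namespace FermionInteraction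

variable {Ψ : FermionInteraction d}

/-- Translation preserves inclusions of regions. [cite: ArakiMoriya2003, §4.1 Def. 4.3] -/
private theorem shiftSet_subset_shiftSet {X Λ : Finset (Site d)} (h : X ⊆ Λ) (v : Site d) : shiftSet v X ⊆ shiftSet v Λ :=
  Finset.map_subset_map.2 h

/-- Undoing a translation. [cite: ArakiMoriya2003, §4.1 Def. 4.3] -/
private theorem shiftSet_neg_shiftSet (v : Site d) (X : Finset (Site d)) : shiftSet (-v) (shiftSet v X) = X := by
  rw [shiftSet_shiftSet', add_neg_cancel]
  ext y
  rw [mem_shiftSet, sub_zero]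

/-- **COVARIANCE OF THE LOCAL HAMILTONIANS**: `Γ(τ_v)(H_Λ) = H_{Λ+v}` for a translation-covariant interaction.
[cite: BratteliRobinsonII1997, §6.2.4 (Prop. 6.2.39 ff.)] [cite: ArakiMoriya2003, §5.1 (local Hamiltonian H(I))] -/
theorem IsTranslationInvariant.fermionEmbed_shiftEmb_localHamiltonian (hT : Ψ.IsTranslationInvariant) (v : Site d)
    (Λ : Finset (Site d)) :
    fermionEmbed (PolySite.shiftEmb v Λ) (Ψ.localHamiltonian Λ) = Ψ.localHamiltonian (shiftSet v Λ) := by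
  rw [Ψ.localHamiltonian_eq_sum Λ, Ψ.localHamiltonian_eq_sum (shiftSet v Λ), map_sum]
  refine Finset.sum_nbij' (fun X => shiftSet v X) (fun Y => shiftSet (-v) Y) (fun X hX => ?_) (fun Y hY => ?_)
    (fun X _ => shiftSet_neg_shiftSet v X) (fun Y _ => ?_) (fun X hX => ?_)
  · rw [Finset.mem_powerset] at hX ⊢
    exact shiftSet_subset_shiftSet hX v
  · rw [Finset.mem_powerset] at hY ⊢
    have h := shiftSet_subset_shiftSet hY (-v)
    rwa [shiftSet_neg_shiftSet] at h
  · rw [shiftSet_shiftSet', neg_add_cancel]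
    ext y
    rw [mem_shiftSet, sub_zero]
  · rw [Finset.mem_powerset] at hX
    rw [dif_pos hX, dif_pos (shiftSet_subset_shiftSet hX v), hT v X, fermionEmbed_fermionEmbed, fermionEmbed_fermionEmbed]
    exact congrFun (congrArg _ (fermionEmbed_congr fun y => rfl)) _

/-- **Covariance followed by isotony**: for `Λ + v ⊆ Λ'`, `Γ(Λ+v ⊆ Λ')(Γ(τ_v) H_Λ) = Γ(Λ+v ⊆ Λ') H_{Λ+v}` as one embedding.
[cite: BratteliRobinsonII1997, §6.2.4 (Prop. 6.2.39 ff.)] -/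
theorem IsTranslationInvariant.fermionEmbed_shiftEmb_trans_incl_localHamiltonian (hT : Ψ.IsTranslationInvariant) (v : Site d)
    {Λ Λ' : Finset (Site d)} (h : shiftSet v Λ ⊆ Λ') :
    fermionEmbed ((PolySite.shiftEmb v Λ).trans (PolySite.incl h)) (Ψ.localHamiltonian Λ) =
      fermionEmbed (PolySite.incl h) (Ψ.localHamiltonian (shiftSet v Λ)) := by
  rw [← fermionEmbed_fermionEmbed, hT.fermionEmbed_shiftEmb_localHamiltonian]

end FermionInteraction

/-! ### §3 Partition functions of embedded Hamiltonians -/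

section Embed

variable {Λ Λ' : Type*} [LinearOrder Λ] [Fintype Λ] [LinearOrder Λ'] [Fintype Λ']

/-- **`Z_{Λ'}(Γ_φ H) = 2^{|Orb Λ'| − |Orb Λ|} · Z_Λ(H)`**: embedding a Hamiltonian into a larger algebra multiplies the partition function by the
dimension of the spectator factor. [cite: BratteliRobinsonII1997, §5.2.2 (the trace state is a product state)] -/
theorem partitionFn_fermionEmbed (φ : Λ ↪ Λ') (β : ℝ) (H : Matrix (Finset (Orb Λ)) (Finset (Orb Λ)) ℂ) :
    Matrix.partitionFn β (fermionEmbed φ H) = 2 ^ (Fintype.card (Orb Λ') - Fintype.card (Orb Λ)) * Matrix.partitionFn β H := by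
  rw [Matrix.partitionFn, Matrix.partitionFn, Matrix.gibbsWeight, Matrix.gibbsWeight, ← map_smul, ← fermionEmbed_exp, trace_fermionEmbed]

/-- **`log Re Z_{Λ'}(Γ_φ H) = log Re Z_Λ(H) + (|Orb Λ'| − |Orb Λ|)·log 2`** (Hermitian `H`, nonempty index types).
[cite: BratteliRobinsonII1997, §5.2.2] -/
theorem log_partitionFn_fermionEmbed (φ : Λ ↪ Λ') (β : ℝ) {H : Matrix (Finset (Orb Λ)) (Finset (Orb Λ)) ℂ} (hH : H.IsHermitian) :
    Real.log (Matrix.partitionFn β (fermionEmbed φ H)).re =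
      Real.log (Matrix.partitionFn β H).re + (Fintype.card (Orb Λ') - Fintype.card (Orb Λ) : ℕ) * Real.log 2 := by
  have hZ : 0 < (Matrix.partitionFn β H).re := partitionFn_re_pos hH β
  have h2 : ((2 : ℂ) ^ (Fintype.card (Orb Λ') - Fintype.card (Orb Λ)) * Matrix.partitionFn β H).re =
      (2 : ℝ) ^ (Fintype.card (Orb Λ') - Fintype.card (Orb Λ)) * (Matrix.partitionFn β H).re := by
    have e : (2 : ℂ) ^ (Fintype.card (Orb Λ') - Fintype.card (Orb Λ)) =
        (((2 : ℝ) ^ (Fintype.card (Orb Λ') - Fintype.card (Orb Λ)) : ℝ) : ℂ) := by push_cast; rfl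
    rw [e, Complex.re_ofReal_mul]
  rw [partitionFn_fermionEmbed, h2, Real.log_mul (pow_ne_zero _ two_ne_zero) hZ.ne', Real.log_pow]
  ring

/-- `|Orb Λ| = 2|Λ|` for a region `Λ ⊆ ℤ^d`. [cite: ArakiMoriya2003, §4.1] -/
theorem card_orb_polySite (Λ : Finset (Site d)) : Fintype.card (Orb (PolySite Λ)) = Λ.card * 2 := by
  have hc : (lexSites Λ).card = Λ.card := by rw [lexSites, Finset.card_map]
  rw [Fintype.card_lex, Fintype.card_prod, Fintype.card_fin, Fintype.card_coe, hc]

end Embed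

/-! ### §4 Decoupled Hamiltonians over translated copies of a region -/

section Translates

variable {K : Type*} [Fintype K] [DecidableEq K] {Ψ : FermionInteraction d} {Λ₀ Λ' : Finset (Site d)} {v : K → Site d}

omit [DecidableEq K] in
/-- **The decoupled Hamiltonian over translates**: with legs `τ_{v_k}` followed by isotony into `Λ' ⊇ Λ₀ + v_k`,
`Σ_k Γ_k(H_{Λ₀}) = Σ_k Γ(Λ₀+v_k ⊆ Λ')(H_{Λ₀+v_k})`. [cite: BratteliRobinsonII1997, §6.2.4 (Prop. 6.2.39 ff.)] -/
theorem decoupledSum_translates_eq (hT : Ψ.IsTranslationInvariant) (h : ∀ k, shiftSet (v k) Λ₀ ⊆ Λ') :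
    decoupledSum (fun k => (PolySite.shiftEmb (v k) Λ₀).trans (PolySite.incl (h k))) (Ψ.localHamiltonian Λ₀) =
      ∑ k, fermionEmbed (PolySite.incl (h k)) (Ψ.localHamiltonian (shiftSet (v k) Λ₀)) := by
  rw [decoupledSum]
  exact Finset.sum_congr rfl fun k _ => hT.fermionEmbed_shiftEmb_trans_incl_localHamiltonian (v k) (h k)

omit [Fintype K] [DecidableEq K] in
/-- **Disjoint translates give disjoint legs.** [cite: ArakiMoriya2003, §11.1 (mutually disjoint regions)] -/
theorem disjoint_legs_of_disjoint_shiftSet (h : ∀ k, shiftSet (v k) Λ₀ ⊆ Λ')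
    (hdisj : ∀ k j, k ≠ j → Disjoint (shiftSet (v k) Λ₀) (shiftSet (v j) Λ₀)) (k j : K) (hkj : k ≠ j) :
    Disjoint ((Finset.univ : Finset (PolySite Λ₀)).map ((PolySite.shiftEmb (v k) Λ₀).trans (PolySite.incl (h k))))
      ((Finset.univ : Finset (PolySite Λ₀)).map ((PolySite.shiftEmb (v j) Λ₀).trans (PolySite.incl (h j)))) := by
  rw [Finset.disjoint_left]
  intro p hpk hpj
  rw [Finset.mem_map] at hpk hpj
  obtain ⟨a, -, ha⟩ := hpk
  obtain ⟨b, -, hb⟩ := hpj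
  have hak : ofLex p.1 ∈ shiftSet (v k) Λ₀ := by rw [← ha]; exact PolySite.ofLex_mem _
  have hbj : ofLex p.1 ∈ shiftSet (v j) Λ₀ := by rw [← hb]; exact PolySite.ofLex_mem _
  exact Finset.disjoint_left.1 (hdisj k j hkj) hak hbj

/-- **`log Z` of the decoupled Hamiltonian over TILING translates**: if the translates `Λ₀ + v_k` are pairwise disjoint, lie in `Λ'` and
`|Λ'| = |K|·|Λ₀|`, then for a Hermitian even `Ψ`: `log Re Z_{Λ'}(Σ_k Γ H_{Λ₀+v_k}) = |K| · log Re Z_{Λ₀}(H_{Λ₀})`.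
[cite: BratteliRobinsonII1997, §5.2.2] -/
theorem log_partitionFn_decoupledSum_translates (hT : Ψ.IsTranslationInvariant) (hH : Ψ.IsHermitian) (hE : Ψ.IsEven)
    (h : ∀ k, shiftSet (v k) Λ₀ ⊆ Λ') (hdisj : ∀ k j, k ≠ j → Disjoint (shiftSet (v k) Λ₀) (shiftSet (v j) Λ₀))
    (hcard : Λ'.card = Fintype.card K * Λ₀.card) (β : ℝ) :
    Real.log (Matrix.partitionFn β (∑ k, fermionEmbed (PolySite.incl (h k)) (Ψ.localHamiltonian (shiftSet (v k) Λ₀)))).re =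
      Fintype.card K * Real.log (Matrix.partitionFn β (Ψ.localHamiltonian Λ₀)).re := by
  rw [← decoupledSum_translates_eq hT h]
  exact log_partitionFn_decoupledSum (disjoint_legs_of_disjoint_shiftSet h hdisj) (FermionInteraction.localHamiltonian_isHermitian hH Λ₀)
    (FermionInteraction.parityAut_localHamiltonian hE Λ₀) (by rw [card_orb_polySite, card_orb_polySite, hcard, mul_assoc]) β

end Translates

end Literature.MathematicalPhysics.QuantumLattice

end
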